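import Mathlib
import HarnessLib
import Summits.HubbardSuperconductivity.HubbardSuperconductivity.Theorems.KLProgrammeKLRegimeTwoVolumeFarStep
import Literature.MathematicalPhysics.QuantumLattice.GrassmannKernelMeanValue
import Literature.MathematicalPhysics.QuantumLattice.GrassmannPolchinskiEquation
import Literature.MathematicalPhysics.QuantumLattice.GrassmannGaussConvKernelBound
import Literature.MathematicalPhysics.QuantumLattice.HubbardMatsubaraShellGrid

/-!
# Route `KLProgramme` — crux K3, (E3f)₀ of stmt-HubbardSuperconductivity-19918, the CUTOFF leg: the covariance-response step
# `effAction (C + D) W − effAction C W` for a perturbation `D` with small ROW SUMS (cell gate-hubbard-kl, seat hubbard-kl-k3c4-p2 g5;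
# technique «Matsubara all-U route», memo CUTOFF-EMBEDDING.md §7)

WHAT.  The twin of `…TwoVolumeFarStep.sum_norm_kernel_effAction_sub_self_le_of_far` (k3c5-p2) for a perturbation `D` of a covariance `C` whose
smallness is in its ROW/COLUMN sums `cR, cC` and sup entry `sD` (no far-support, no first moments).  Along the straight path
`t ↦ 𝒱_t := effAction (C + t • D) W` (`𝒱_0 = effAction C W`, `𝒱_1 = effAction (C + D) W`) the tree's Polchinski equation
(`hasCoeffDerivAt_effAction_flow`) and the mean-value bound for pinned kernel sums (`sum_norm_kernel_sub_le_of_hasCoeffDerivAt`) reduce the pinned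
`L¹` kernels of the difference to those of `Δ_D 𝒱_t − ½(δ𝒱_t/δψ, D δ𝒱_t/δψ)`, uniformly in `t`; the contraction term is
`GrassmannGaussConvKernelBound.sum_norm_kernel_grassmannLaplacian_le` (`(n+2)(n+3)/2 · sD · N_{n+3}(𝒱_t)`) and the bilinear term is
`…TwoVolumePairingBound.sum_norm_kernel_bilinear_le_weighted` with the unit weight (`Σ_{a+b=n+1}(a+1)(b+1)(cR·tV·nV + cC·nV·tV)`):

* **`sum_norm_kernel_effAction_add_sub_le_of_rowSums`** — for every degree `n + 1` and pin `(p, w)`: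
  `Σ_{X : X_p = w} ‖kernel (effAction (C + D) W) (n+1) X − kernel (effAction C W) (n+1) X‖
     ≤ (n+2)(n+3)/2 · sD · nL(n+3) + ‖2⁻¹‖·Σ_{a+b=n+1}(a+1)(b+1)·(cR·tV(a+1)·nV(b+1) + cC·nV(a+1)·tV(b+1))`,
  given UNIFORMLY in `t ∈ [0,1]` a non-vanishing partition function and kernel data of `𝒱_t` (leg-`0`-pinned `nV`, pinned-at-`w` `tV`, and the
  degree-`n+3` pin-at-`w` bound `nL`).

APPLICATION (the cutoff leg of (E3f)₀, memo §7–§8): on the common `N`-grid `C = C_g` (cutoff `M`, scale `Λ₀`), `D = S_g` (the Matsubara shell,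
`HubbardMatsubaraShellGrid.gridSub_hubbardCovAboveCT_eq_add_shell`: `C″_g = C_g + S_g`), `W` the grid vertex; `cR = cC` = the shell row sum
(`HubbardMatsubaraShellRowSum`, `O(N/√M)`), `sD = κ_S²` (`HubbardMatsubaraShellGram`); the kernel data of `𝒱_t` come from the determinant-bounded
step at the interpolated covariance (Gram form `C_g ⊕ tS_g`, `GrassmannGramFormAlgebra`) and carry the grid weight `β/N` per vertex, so the right
side is `O(|U|β/√M)` — the per-dyadic-step size chained by `MatsubaraDyadicChaining`.  Everything is proved; no definition, no named fact;
nothing about the model is asserted in the theorem.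
-/

noncomputable section

namespace Summit.HubbardSuperconductivity.HubbardSuperconductivity.Theorems.TwoVolumeDefect

set_option linter.dupNamespace false -- summit = problem name (single-conjunct summit), D-0017

open Finset Literature.MathematicalPhysics.QuantumLattice GrassmannAlgebra

variable {𝕜 : Type*} [RCLike 𝕜] {Γ : Type*} [LinearOrder Γ] [Fintype Γ]

/-- **THE COVARIANCE-RESPONSE STEP WITH ROW SUMS.**  See the module docstring: pinned `L¹` kernels of `effAction (C + D) W − effAction C W` are
bounded by the sup entry `sD` of `D` against the degree-`n+3` pinned norm, plus the row/column sums `cR, cC` of `D` against products of pinned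
norms — all of the interpolated effective actions `𝒱_t = effAction (C + t•D) W`, uniformly in `t ∈ [0,1]`. -/
theorem sum_norm_kernel_effAction_add_sub_le_of_rowSums (C D : Matrix Γ Γ 𝕜) (W : GrassmannAlgebra 𝕜 Γ)
    (hW0 : constPart 𝕜 W = 0) (hWe : W ∈ evenOdd 𝕜 0)
    (hZ : ∀ s ∈ Set.Icc (0 : ℝ) 1, effPartitionFn 𝕜 (C + (s : ℝ) • D) W ≠ 0)
    {sD : ℝ} (hsD : ∀ X Y, ‖D X Y‖ ≤ sD)
    {cR cC : ℝ} (hcR : 0 ≤ cR) (hcC : 0 ≤ cC) (hR : ∀ X, ∑ Y, ‖D X Y‖ ≤ cR) (hC : ∀ Y, ∑ X, ‖D X Y‖ ≤ cC) (w : Γ)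
    (nV tV nL : ℕ → ℝ) (hnV : ∀ m, 0 ≤ nV m) (htV : ∀ m, 0 ≤ tV m)
    (hV0 : ∀ s ∈ Set.Icc (0 : ℝ) 1, ∀ (m : ℕ) (x : Γ),
      ∑ U ∈ univ.filter (fun U : Fin (m + 1) → Γ => U 0 = x), ‖kernel 𝕜 (effAction 𝕜 (C + (s : ℝ) • D) W) (m + 1) U‖ ≤ nV (m + 1))
    (hVt : ∀ s ∈ Set.Icc (0 : ℝ) 1, ∀ (m : ℕ) (i : Fin m),
      ∑ U ∈ univ.filter (fun U : Fin (m + 1) → Γ => U i.succ = w), ‖kernel 𝕜 (effAction 𝕜 (C + (s : ℝ) • D) W) (m + 1) U‖ ≤ tV (m + 1))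
    (n : ℕ) (p : Fin (n + 1))
    (hVL : ∀ s ∈ Set.Icc (0 : ℝ) 1,
      ∑ Z ∈ univ.filter (fun Z : Fin (n + 1 + 1 + 1) → Γ => Z (Fin.castSucc (Fin.castSucc p)) = w),
        ‖kernel 𝕜 (effAction 𝕜 (C + (s : ℝ) • D) W) (n + 1 + 2) Z‖ ≤ nL (n + 3)) :
    ∑ X ∈ univ.filter (fun X : Fin (n + 1) → Γ => X p = w),
        ‖kernel 𝕜 (effAction 𝕜 (C + D) W) (n + 1) X - kernel 𝕜 (effAction 𝕜 C W) (n + 1) X‖ ≤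
      (((n + 1 + 1) * (n + 1 + 2) : ℕ) : ℝ) / 2 * sD * nL (n + 3) +
        ‖(2 : 𝕜)⁻¹‖ * ∑ a ∈ range (n + 2), ∑ b ∈ range (n + 2),
          (if a + b = n + 1 then (((a + 1) * (b + 1) : ℕ) : ℝ) * (cR * tV (a + 1) * nV (b + 1) + cC * nV (a + 1) * tV (b + 1)) else 0) := by
  -- the path and Polchinski's equation along it
  set V : ℝ → GrassmannAlgebra 𝕜 Γ := fun s => effAction 𝕜 (C + (s : ℝ) • D) W with hV
  set RHS : ℝ → GrassmannAlgebra 𝕜 Γ := fun s =>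
    grassmannLaplacian 𝕜 D (V s) - (2 : 𝕜)⁻¹ • grassmannDerivPairing 𝕜 D (V s) (V s)
      - constPart 𝕜 (grassmannLaplacian 𝕜 D (V s) - (2 : 𝕜)⁻¹ • grassmannDerivPairing 𝕜 D (V s) (V s)) • 1 with hRHS
  have hpath : ∀ X Y (t : ℝ), HasDerivAt (fun r : ℝ => (C + (r : ℝ) • D) X Y) (D X Y) t := by
    intro X Y t
    have h := ((hasDerivAt_id t).smul_const (D X Y)).const_add (C X Y)
    simpa [Matrix.add_apply, Matrix.smul_apply] using h
  have hderiv : ∀ s ∈ Set.Icc (0 : ℝ) 1, HasCoeffDerivAt V (RHS s) s := fun s hs =>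
    (hasCoeffDerivAt_effAction_flow (C := fun r : ℝ => C + (r : ℝ) • D) (fun X Y => hpath X Y s) hW0 hWe (hZ s hs)).1
  -- endpoints
  have hV1 : V 1 = effAction 𝕜 (C + D) W := by simp [hV]
  have hV0' : V 0 = effAction 𝕜 C W := by simp [hV]
  -- the pinned kernel bound of the right side, uniformly in `s`
  set B : ℝ := (((n + 1 + 1) * (n + 1 + 2) : ℕ) : ℝ) / 2 * sD * nL (n + 3) +
    ‖(2 : 𝕜)⁻¹‖ * ∑ a ∈ range (n + 2), ∑ b ∈ range (n + 2),
      (if a + b = n + 1 then (((a + 1) * (b + 1) : ℕ) : ℝ) * (cR * tV (a + 1) * nV (b + 1) + cC * nV (a + 1) * tV (b + 1)) else 0) with hB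
  have hsD0 : 0 ≤ sD := (norm_nonneg _).trans (hsD w w)
  have hbound : ∀ s ∈ Set.Icc (0 : ℝ) 1,
      ∑ X ∈ univ.filter (fun X : Fin (n + 1) → Γ => X p = w), ‖kernel 𝕜 (RHS s) (n + 1) X‖ ≤ B := by
    intro s hs
    -- contraction term (sup entry of `D`)
    have hlap := sum_norm_kernel_grassmannLaplacian_le D hsD (V s) (n + 1) p w
    -- bilinear term (row / column sums of `D`, unit weight)
    have hbil := sum_norm_kernel_bilinear_le_weighted D (fun _ => (1 : ℝ)) hcR hcC (fun X => by simpa using hR X) (fun Y => by simpa using hC Y)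
      (V s) (V s) w nV nV tV tV htV htV hnV hnV (hV0 s hs) (hV0 s hs)
      (fun m i => by simpa using hVt s hs m i) (fun m j => by simpa using hVt s hs m j) n p
    calc ∑ X ∈ univ.filter (fun X : Fin (n + 1) → Γ => X p = w), ‖kernel 𝕜 (RHS s) (n + 1) X‖
        = ∑ X ∈ univ.filter (fun X : Fin (n + 1) → Γ => X p = w),
            ‖kernel 𝕜 (grassmannLaplacian 𝕜 D (V s)) (n + 1) X -
              (2 : 𝕜)⁻¹ * kernel 𝕜 (grassmannDerivPairing 𝕜 D (V s) (V s)) (n + 1) X‖ := by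
          refine sum_congr rfl fun X _ => ?_
          rw [hRHS]
          simp only
          rw [kernel_sub_sub_smul_one_succ, kernel_smul]
      _ ≤ ∑ X ∈ univ.filter (fun X : Fin (n + 1) → Γ => X p = w),
            (‖kernel 𝕜 (grassmannLaplacian 𝕜 D (V s)) (n + 1) X‖ +
              ‖(2 : 𝕜)⁻¹‖ * ‖kernel 𝕜 (grassmannDerivPairing 𝕜 D (V s) (V s)) (n + 1) X‖) :=
          sum_le_sum fun X _ => (norm_sub_le _ _).trans (by rw [norm_mul])
      _ = ∑ X ∈ univ.filter (fun X : Fin (n + 1) → Γ => X p = w), ‖kernel 𝕜 (grassmannLaplacian 𝕜 D (V s)) (n + 1) X‖ +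
            ‖(2 : 𝕜)⁻¹‖ * ∑ X ∈ univ.filter (fun X : Fin (n + 1) → Γ => X p = w),
              ‖kernel 𝕜 (grassmannDerivPairing 𝕜 D (V s) (V s)) (n + 1) X‖ := by
          rw [sum_add_distrib, mul_sum]
      _ ≤ B := by
          rw [hB]
          refine add_le_add (hlap.trans ?_) (mul_le_mul_of_nonneg_left ?_ (norm_nonneg _))
          · exact mul_le_mul_of_nonneg_left (hVL s hs) (by positivity)
          · rw [grassmannDerivPairing_apply] at *
            exact hbil
  -- mean value
  have hmvt := sum_norm_kernel_sub_le_of_hasCoeffDerivAt hderiv (n + 1) (univ.filter (fun X : Fin (n + 1) → Γ => X p = w)) hbound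
  rw [hV1, hV0'] at hmvt
  exact hmvt

end Summit.HubbardSuperconductivity.HubbardSuperconductivity.Theorems.TwoVolumeDefect

end
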